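import Literature.Computability.Complexity.IrreducibilityLLLPolyArith
import Mathlib.FieldTheory.Finite.Basic
import HarnessLib

/-!
# The extended Euclidean algorithm in `𝔽_p[X]` on coefficient lists (for LLL 1982, §3)

Support file for the discharge of the named fact
`Literature.Computability.Complexity.lll_monicIrreducible_mem_P` (irreducibility of monic integer
polynomials is decidable in `P`; Lenstra–Lenstra–Lovász 1982, §3). Step (3.1) of LLL82 needs, modulo
a small prime `p`: the squarefreeness test `gcd(f, f') = 1`, the gcds `gcd(f, v - s)` of Berlekamp's
splitting, and (for Hensel's lemma, (3.2)) Bezout coefficients `s h + t g = 1`. This file writes the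
extended Euclidean algorithm for `𝔽_p[X]` as a total functional program on coefficient lists
(`List ℤ`, low degree first, normal forms of `IrreducibilityLLLPolyArith.lean`) — a fold over a
unary budget, every intermediate result reduced modulo `p` — and proves its specification in
`(ZMod p)[X]` through `toZMod p`:

* `invMod p c = c^{p-2} mod p` (a fold; Fermat), `monicize p a` (divide by the leading entry);
* `xgcdStep`, `pxgcd p a b = (g, s, t)`;
* `toZMod_injective_of_normal` — normal lists with the same polynomial are equal;
* **`pxgcd_spec`** (`p` prime): `ḡ = s̄ ā + t̄ b̄`, `ḡ ∣ ā`, `ḡ ∣ b̄`, `g` normal and monic unless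
  `ā = b̄ = 0` (then `g = []`); consequently `isCoprime_iff_pxgcd_eq_one`
  (`IsCoprime ā b̄ ↔ g = [1]`) and `natDegree_gcd_eq` (`deg ḡ = |g| - 1`, `ḡ` is THE normalised
  gcd up to the unit normalisation of Mathlib's `GCDMonoid`: `associated_pxgcd_gcd`);
* length bounds along the run (`|g| ≤ max |a| |b|`, `|s|, |t| ≤ (|b|+2)(|a|+|b|+2)`) for the
  machine-level accumulator estimates.

## References

* D. E. Knuth, *The Art of Computer Programming*, Vol. 2, 3rd ed., 1998, §4.6.1 (Euclid's
  algorithm for polynomials over a field; the extended algorithm, exercise 3). [KnuthTAOCP2]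
* A. K. Lenstra, H. W. Lenstra Jr., L. Lovász, *Factoring polynomials with rational coefficients*,
  Math. Ann. 261 (1982), §3, (3.1)–(3.2) and proof of (3.6) (`R(f, f') ≢ 0 mod p`, Berlekamp,
  Hensel). [LenstraLenstraLovasz1982]
-/

noncomputable section

namespace Literature.Computability.Complexity

open Polynomial SumcheckMA

namespace LLLFactoring

variable {M : ℕ}

/-! ### Normal lists are determined by their polynomials -/

/-- Reduced entries with the same residue are equal. [folklore] -/
theorem eq_of_cast_eq_of_reduced {c d : ℤ} (hc : 0 ≤ c ∧ c < M) (hd : 0 ≤ d ∧ d < M)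
    (h : ((c : ℤ) : ZMod M) = ((d : ℤ) : ZMod M)) : c = d := by
  have h1 : ((c - d : ℤ) : ZMod M) = 0 := by push_cast; rw [h, sub_self]
  rw [ZMod.intCast_zmod_eq_zero_iff_dvd] at h1
  rcases lt_trichotomy c d with hlt | heq | hgt
  · have : (M : ℤ) ∣ d - c := by rw [← neg_sub]; exact dvd_neg.2 h1
    exact absurd (Int.le_of_dvd (by omega) this) (by omega)
  · exact heq
  · exact absurd (Int.le_of_dvd (by omega) h1) (by omega)

/-- **Normal lists with the same polynomial modulo `M` are equal.** [folklore] -/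
theorem toZMod_injective_of_normal {a b : List ℤ} (ha : Normal M a) (hb : Normal M b)
    (h : toZMod M a = toZMod M b) : a = b := by
  -- equal lengths
  have hlen : a.length = b.length := by
    by_cases ha0 : a = []
    · subst ha0
      have : toZMod M b = 0 := by rw [← h, toZMod_nil]
      rw [hb.toZMod_eq_zero_iff.1 this]
    · by_cases hb0 : b = []
      · subst hb0
        have : toZMod M a = 0 := by rw [h, toZMod_nil]
        exact absurd (ha.toZMod_eq_zero_iff.1 this) ha0
      · have h1 := (ha.natDegree_toZMod ha0).1
        have h2 := (hb.natDegree_toZMod hb0).1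
        rw [h] at h1
        have := List.length_pos_of_ne_nil ha0
        have := List.length_pos_of_ne_nil hb0
        omega
  refine List.ext_getElem hlen fun i h₁ h₂ => ?_
  have hc := congrArg (fun q => q.coeff i) h
  simp only [coeff_toZMod, List.getD_eq_getElem _ _ h₁, List.getD_eq_getElem _ _ h₂] at hc
  exact eq_of_cast_eq_of_reduced (ha.1 _ (List.getElem_mem h₁)) (hb.1 _ (List.getElem_mem h₂)) hc

/-- The normal form of the constant `1` (`M ≥ 2`). [folklore] -/
theorem pnorm_one (hM : 1 < M) : pnorm M [1] = [1] := by
  have : (1 : ℤ) % (M : ℤ) = 1 := Int.emod_eq_of_lt (by norm_num) (by exact_mod_cast hM)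
  simp [pnorm, pmod, this, trim, List.rdropWhile]

/-- A normal list represents `1` iff it is `[1]` (`M ≥ 2`). [folklore] -/
theorem toZMod_eq_one_iff_of_normal (hM : 1 < M) {a : List ℤ} (ha : Normal M a) : toZMod M a = 1 ↔ a = [1] := by
  have h1 : toZMod M [1] = 1 := by simp [toZMod_cons]
  constructor
  · intro h
    exact toZMod_injective_of_normal ha (by rw [← pnorm_one hM]; exact normal_pnorm (by omega) _) (by rw [h, h1])
  · rintro rfl; exact h1

/-! ### Inverses modulo a prime and normalisation to monic -/

/-- `c^e mod p` by `e` multiplications, every product reduced (a fold over a unary budget).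
[cite: KnuthTAOCP2, §4.6.1] -/
def powMod (p : ℕ) (c : ℤ) (e : ℕ) : ℤ := (List.replicate e ()).foldl (fun acc _ => acc * c % (p : ℤ)) 1

/-- `powMod` computes the power modulo `p`. [folklore] -/
theorem cast_powMod (p : ℕ) (c : ℤ) : ∀ e : ℕ, ((powMod p c e : ℤ) : ZMod p) = ((c : ℤ) : ZMod p) ^ e
  | 0 => by simp [powMod]
  | e + 1 => by
    rw [powMod, List.replicate_succ', List.foldl_append, List.foldl_cons, List.foldl_nil, ← powMod,
      ZMod.intCast_mod, Int.cast_mul, cast_powMod p c e, pow_succ]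

/-- `powMod` is reduced for `e ≥ 1` and `p ≥ 1`. [folklore] -/
theorem powMod_bounds {p : ℕ} (hp : 0 < p) (c : ℤ) {e : ℕ} (he : 0 < e) : 0 ≤ powMod p c e ∧ powMod p c e < p := by
  obtain ⟨e, rfl⟩ := Nat.exists_eq_succ_of_ne_zero he.ne'
  rw [powMod, List.replicate_succ', List.foldl_append, List.foldl_cons, List.foldl_nil]
  have hp' : (0 : ℤ) < p := by exact_mod_cast hp
  exact ⟨Int.emod_nonneg _ hp'.ne', Int.emod_lt_of_pos _ hp'⟩

/-- The inverse of a unit residue modulo the prime `p`: `c^{p-2} mod p` (Fermat), reduced once more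
so that it lies in `[0, p)` also for `p = 2`. [cite: KnuthTAOCP2, §4.6.1 (arithmetic modulo p)] -/
def invMod (p : ℕ) (c : ℤ) : ℤ := powMod p c (p - 2) % (p : ℤ)

/-- `invMod` inverts nonzero residues modulo a prime. [folklore] -/
theorem cast_invMod_mul {p : ℕ} [hp : Fact p.Prime] {c : ℤ} (hc : ((c : ℤ) : ZMod p) ≠ 0) :
    ((invMod p c : ℤ) : ZMod p) * ((c : ℤ) : ZMod p) = 1 := by
  rw [invMod, ZMod.intCast_mod, cast_powMod, ← pow_succ]
  have h2 := hp.out.two_le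
  have : p - 2 + 1 = p - 1 := by omega
  rw [this]
  exact ZMod.pow_card_sub_one_eq_one hc

/-- `invMod` is reduced (`p ≥ 1`). [folklore] -/
theorem invMod_bounds {p : ℕ} (hp : 0 < p) (c : ℤ) : 0 ≤ invMod p c ∧ invMod p c < p := by
  have hp' : (0 : ℤ) < p := by exact_mod_cast hp
  exact ⟨Int.emod_nonneg _ hp'.ne', Int.emod_lt_of_pos _ hp'⟩

/-- Divide a list by its leading entry modulo the prime `p` (normal form): the monic
representative of the same ideal. [cite: KnuthTAOCP2, §4.6.1] -/
def monicize (p : ℕ) (a : List ℤ) : List ℤ := pnorm p (pscale (invMod p (a.getLast?.getD 0)) a)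

/-- The scaling factor of `monicize`. [folklore] -/
def monicizer (p : ℕ) (a : List ℤ) : ℤ := invMod p (a.getLast?.getD 0)

/-- `toZMod` of `monicize`: `C (lead a)⁻¹ · ā`. [folklore] -/
theorem toZMod_monicize (p : ℕ) (a : List ℤ) :
    toZMod p (monicize p a) = C ((monicizer p a : ℤ) : ZMod p) * toZMod p a := by
  rw [monicize, toZMod_pnorm, toZMod_pscale]; rfl

/-- **`monicize` of a nonempty normal list is monic of the same degree** (`p` prime), its scaling
factor is a unit, and it is normal of the same length. [cite: KnuthTAOCP2, §4.6.1] -/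
theorem monicize_spec {p : ℕ} [hp : Fact p.Prime] {a : List ℤ} (ha : Normal p a) (ha0 : a ≠ []) :
    (toZMod p (monicize p a)).Monic ∧ (toZMod p (monicize p a)).natDegree = a.length - 1 ∧
      Normal p (monicize p a) ∧ (monicize p a).length = a.length ∧
      IsUnit (((monicizer p a : ℤ) : ZMod p)) := by
  have hp0 : 0 < p := hp.out.pos
  obtain ⟨hdeg, hlead⟩ := ha.natDegree_toZMod ha0
  have hlast : a.getLast?.getD 0 = a.getLast ha0 := getLast?_getD_eq_getLast ha0
  have hc0 : ((a.getLast ha0 : ℤ) : ZMod p) ≠ 0 := by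
    rw [← hlead]; intro h
    exact absurd (leadingCoeff_eq_zero.1 h) (fun h0 => ha0 (ha.toZMod_eq_zero_iff.1 h0))
  have hinv : ((monicizer p a : ℤ) : ZMod p) * ((a.getLast ha0 : ℤ) : ZMod p) = 1 := by
    rw [monicizer, hlast]; exact cast_invMod_mul hc0
  have hunit : IsUnit ((monicizer p a : ℤ) : ZMod p) := isUnit_iff_exists_inv.2 ⟨_, hinv⟩
  have hne : toZMod p a ≠ 0 := fun h0 => ha0 (ha.toZMod_eq_zero_iff.1 h0)
  have hmonic : (toZMod p (monicize p a)).Monic := by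
    rw [Monic, toZMod_monicize, leadingCoeff_mul, leadingCoeff_C, hlead, hinv]
  have hdeg' : (toZMod p (monicize p a)).natDegree = a.length - 1 := by
    rw [toZMod_monicize, natDegree_C_mul hunit.ne_zero, hdeg]
  have hnorm : Normal p (monicize p a) := normal_pnorm hp0 _
  have hne' : monicize p a ≠ [] := fun h => by
    have := hmonic.ne_zero; rw [h, toZMod_nil] at this; exact this rfl
  have hlen : (monicize p a).length = a.length := by
    have h1 := (hnorm.natDegree_toZMod hne').1
    rw [hdeg'] at h1
    have := List.length_pos_of_ne_nil ha0
    have := List.length_pos_of_ne_nil hne'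
    omega
  exact ⟨hmonic, hdeg', hnorm, hlen, hunit⟩

/-! ### The extended Euclidean loop -/

/-- The state of the extended Euclidean algorithm: `((r₀, r₁), (s₀, s₁), (t₀, t₁))` with
`rᵢ = sᵢ a + tᵢ b`. [cite: KnuthTAOCP2, §4.6.1 (exercise 3: extended Euclid for polynomials)] -/
abbrev XgcdState := (List ℤ × List ℤ) × (List ℤ × List ℤ) × (List ℤ × List ℤ)

/-- One step: if `r₁ ≠ 0`, normalise `r₁` to monic (`c = lead(r₁)⁻¹`), divide `r₀` by it,
and shift: `(r₁ᵐ, r₀ mod r₁ᵐ)`, `(c s₁, s₀ - q c s₁)`, `(c t₁, t₀ - q c t₁)`, all in normal form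
modulo `p`. [cite: KnuthTAOCP2, §4.6.1] -/
def xgcdStep (p : ℕ) (st : XgcdState) : XgcdState :=
  let r₀ := st.1.1; let r₁ := st.1.2; let s₀ := st.2.1.1; let s₁ := st.2.1.2; let t₀ := st.2.2.1; let t₁ := st.2.2.2
  if r₁ = [] then st else
    let c := monicizer p r₁
    let m := monicize p r₁
    let qr := pdivmod p r₀ m
    let s₁' := pnorm p (pscale c s₁)
    let t₁' := pnorm p (pscale c t₁)
    ((m, pnorm p qr.2), (s₁', pnorm p (psub s₀ (pmul qr.1 s₁'))), (t₁', pnorm p (psub t₀ (pmul qr.1 t₁'))))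

/-- The initial state `((a, b), (1, 0), (0, 1))` in normal form. [cite: KnuthTAOCP2, §4.6.1] -/
def xgcdInit (p : ℕ) (a b : List ℤ) : XgcdState := ((pnorm p a, pnorm p b), (pnorm p [1], []), ([], pnorm p [1]))

/-- The run of the extended Euclidean algorithm with `N` steps. [cite: KnuthTAOCP2, §4.6.1] -/
def xgcdRun (p : ℕ) (a b : List ℤ) (N : ℕ) : XgcdState :=
  (List.replicate N ()).foldl (fun st _ => xgcdStep p st) (xgcdInit p a b)

/-- **The extended gcd modulo `p`**: run `|b| + 1` steps, then normalise the last nonzero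
remainder to monic: returns `(g, s, t)` with `g = s a + t b` the monic gcd (or `([], …)` when
`a ≡ b ≡ 0`). [cite: KnuthTAOCP2, §4.6.1] -/
def pxgcd (p : ℕ) (a b : List ℤ) : List ℤ × List ℤ × List ℤ :=
  let st := xgcdRun p a b (b.length + 1)
  let c := monicizer p st.1.1
  (monicize p st.1.1, pnorm p (pscale c st.2.1.1), pnorm p (pscale c st.2.2.1))

/-- The gcd component. [cite: KnuthTAOCP2, §4.6.1] -/
def pgcd (p : ℕ) (a b : List ℤ) : List ℤ := (pxgcd p a b).1

section Spec

variable {p : ℕ} [hp : Fact p.Prime]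

/-- The loop invariant: Bezout relations for both remainders, normality, and preservation of the
common divisors. [cite: KnuthTAOCP2, §4.6.1] -/
def XgcdInv (p : ℕ) (a b : List ℤ) (st : XgcdState) : Prop :=
  toZMod p st.1.1 = toZMod p st.2.1.1 * toZMod p a + toZMod p st.2.2.1 * toZMod p b ∧
  toZMod p st.1.2 = toZMod p st.2.1.2 * toZMod p a + toZMod p st.2.2.2 * toZMod p b ∧
  Normal p st.1.1 ∧ Normal p st.1.2 ∧ Normal p st.2.1.1 ∧ Normal p st.2.1.2 ∧ Normal p st.2.2.1 ∧ Normal p st.2.2.2 ∧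
  ∀ d : (ZMod p)[X], (d ∣ toZMod p st.1.1 ∧ d ∣ toZMod p st.1.2) ↔ (d ∣ toZMod p a ∧ d ∣ toZMod p b)

omit hp in
/-- The initial state satisfies the invariant (`p ≥ 1`). [folklore] -/
theorem xgcdInv_init (hp0 : 0 < p) (a b : List ℤ) : XgcdInv p a b (xgcdInit p a b) := by
  refine ⟨?_, ?_, normal_pnorm hp0 _, normal_pnorm hp0 _, normal_pnorm hp0 _, ?_, ?_, normal_pnorm hp0 _, fun d => ?_⟩
  · simp [xgcdInit, toZMod_pnorm, toZMod_cons]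
  · simp [xgcdInit, toZMod_pnorm, toZMod_cons]
  · exact ⟨fun _ h => by simp [xgcdInit] at h, by simp [xgcdInit, trim, List.rdropWhile]⟩
  · exact ⟨fun _ h => by simp [xgcdInit] at h, by simp [xgcdInit, trim, List.rdropWhile]⟩
  · simp [xgcdInit, toZMod_pnorm]

omit hp in
/-- The active step, written out. [folklore] -/
theorem xgcdStep_eq {r₀ r₁ s₀ s₁ t₀ t₁ : List ℤ} (hr1 : r₁ ≠ []) :
    xgcdStep p ((r₀, r₁), (s₀, s₁), (t₀, t₁)) =
      ((monicize p r₁, pnorm p (pdivmod p r₀ (monicize p r₁)).2),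
        (pnorm p (pscale (monicizer p r₁) s₁),
          pnorm p (psub s₀ (pmul (pdivmod p r₀ (monicize p r₁)).1 (pnorm p (pscale (monicizer p r₁) s₁))))),
        (pnorm p (pscale (monicizer p r₁) t₁),
          pnorm p (psub t₀ (pmul (pdivmod p r₀ (monicize p r₁)).1 (pnorm p (pscale (monicizer p r₁) t₁)))))) := by
  simp [xgcdStep, hr1]

/-- **One step preserves the invariant**, and strictly shortens `r₁` unless it is already empty.
[cite: KnuthTAOCP2, §4.6.1] -/
theorem xgcdStep_spec {a b : List ℤ} {st : XgcdState} (hst : XgcdInv p a b st) (hr1 : st.1.2 ≠ []) :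
    XgcdInv p a b (xgcdStep p st) ∧ (xgcdStep p st).1.2.length < st.1.2.length ∧
      (xgcdStep p st).1.1.length = st.1.2.length := by
  have hp0 : 0 < p := hp.out.pos
  obtain ⟨⟨r₀, r₁⟩, ⟨s₀, s₁⟩, ⟨t₀, t₁⟩⟩ := st
  obtain ⟨h0, h1, nr0, nr1, ns0, ns1, nt0, nt1, hdiv⟩ := hst
  dsimp only at h0 h1 nr0 nr1 ns0 ns1 nt0 nt1 hdiv hr1
  obtain ⟨hmon, hmdeg, hmnorm, hmlen, hunit⟩ := monicize_spec nr1 hr1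
  set c := monicizer p r₁ with hc
  set m := monicize p r₁ with hm
  have hm0 : m ≠ [] := by rw [← List.length_pos_iff_ne_nil, hmlen]; exact List.length_pos_of_ne_nil hr1
  have hmdeg' : (toZMod p m).natDegree = m.length - 1 := by rw [hmdeg, hmlen]
  have hmZ : toZMod p m = C ((c : ℤ) : ZMod p) * toZMod p r₁ := toZMod_monicize p r₁
  obtain ⟨hqr, -, -, hrlt, -, -⟩ := pdivmod_spec hp0 (a := r₀) hm0 hmon hmdeg'
  set q := (pdivmod p r₀ m).1 with hq
  set r := (pdivmod p r₀ m).2 with hr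
  have hrr : toZMod p r = toZMod p r₀ - toZMod p q * toZMod p m := by rw [hqr]; ring
  rw [xgcdStep_eq hr1]
  refine ⟨⟨?_, ?_, hmnorm, normal_pnorm hp0 _, normal_pnorm hp0 _, normal_pnorm hp0 _, normal_pnorm hp0 _,
    normal_pnorm hp0 _, fun d => ?_⟩, ?_, hmlen⟩
  · -- Bezout for `m = c r₁`
    show toZMod p m = toZMod p (pnorm p (pscale c s₁)) * toZMod p a + toZMod p (pnorm p (pscale c t₁)) * toZMod p b
    rw [hmZ, toZMod_pnorm, toZMod_pnorm, toZMod_pscale, toZMod_pscale, h1]; ring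
  · -- Bezout for `r = r₀ - q m`
    show toZMod p (pnorm p r) = toZMod p (pnorm p (psub s₀ (pmul q (pnorm p (pscale c s₁))))) * toZMod p a +
      toZMod p (pnorm p (psub t₀ (pmul q (pnorm p (pscale c t₁))))) * toZMod p b
    rw [toZMod_pnorm, hrr, toZMod_pnorm, toZMod_pnorm, toZMod_psub, toZMod_psub, toZMod_pmul, toZMod_pmul,
      toZMod_pnorm, toZMod_pnorm, toZMod_pscale, toZMod_pscale, hmZ, h0, h1]
    ring
  · -- common divisors
    show (d ∣ toZMod p m ∧ d ∣ toZMod p (pnorm p r)) ↔ (d ∣ toZMod p a ∧ d ∣ toZMod p b)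
    rw [← hdiv d, toZMod_pnorm]
    obtain ⟨u, hu⟩ := hunit
    constructor
    · rintro ⟨hdm, hdr⟩
      have hdr1 : d ∣ toZMod p r₁ := by
        have : toZMod p r₁ = C ((↑u⁻¹ : ZMod p)) * toZMod p m := by
          rw [hmZ, ← mul_assoc, ← C_mul, ← hu, Units.inv_mul, C_1, one_mul]
        rw [this]; exact Dvd.dvd.mul_left hdm _
      refine ⟨?_, hdr1⟩
      have : toZMod p r₀ = toZMod p r + toZMod p q * toZMod p m := by rw [hrr]; ring
      rw [this]; exact dvd_add hdr (Dvd.dvd.mul_left hdm _)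
    · rintro ⟨hd0, hd1⟩
      have hdm : d ∣ toZMod p m := by rw [hmZ]; exact Dvd.dvd.mul_left hd1 _
      exact ⟨hdm, by rw [hrr]; exact dvd_sub hd0 (Dvd.dvd.mul_left hdm _)⟩
  · -- `r` is shorter than `r₁`
    show (pnorm p r).length < r₁.length
    calc (pnorm p r).length ≤ r.length := length_pnorm_le _
      _ < m.length := hrlt
      _ = r₁.length := hmlen

omit hp in
/-- Idle steps. [folklore] -/
theorem xgcdStep_of_nil {st : XgcdState} (h : st.1.2 = []) : xgcdStep p st = st := by
  obtain ⟨⟨r₀, r₁⟩, s, t⟩ := st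
  dsimp only at h; subst h
  simp [xgcdStep]

/-- **The run**: the invariant holds throughout, and after `j` steps either `r₁ = []` or
`|r₁| + j ≤ |pnorm b|`. [cite: KnuthTAOCP2, §4.6.1] -/
theorem xgcdRun_spec (a b : List ℤ) : ∀ j : ℕ,
    XgcdInv p a b (xgcdRun p a b j) ∧ ((xgcdRun p a b j).1.2 = [] ∨ (xgcdRun p a b j).1.2.length + j ≤ (pnorm p b).length)
  | 0 => ⟨xgcdInv_init hp.out.pos a b, Or.inr (by simp [xgcdRun, xgcdInit])⟩
  | j + 1 => by
    obtain ⟨hinv, hlen⟩ := xgcdRun_spec a b j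
    have hrun : xgcdRun p a b (j + 1) = xgcdStep p (xgcdRun p a b j) := by
      rw [xgcdRun, List.replicate_succ', List.foldl_append, List.foldl_cons, List.foldl_nil, ← xgcdRun]
    rw [hrun]
    by_cases h0 : (xgcdRun p a b j).1.2 = []
    · rw [xgcdStep_of_nil h0]; exact ⟨hinv, Or.inl h0⟩
    · obtain ⟨hinv', hlt, -⟩ := xgcdStep_spec hinv h0
      refine ⟨hinv', ?_⟩
      rcases hlen with h | h
      · exact absurd h h0
      · exact Or.inr (by omega)

/-- After `|b| + 1` steps the second remainder is exhausted. [folklore] -/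
theorem xgcdRun_fst_snd_eq_nil (a b : List ℤ) : (xgcdRun p a b (b.length + 1)).1.2 = [] := by
  rcases (xgcdRun_spec (p := p) a b (b.length + 1)).2 with h | h
  · exact h
  · have := length_pnorm_le (M := p) b; omega

/-- **Specification of the extended gcd** (`p` prime): with `(g, s, t) = pxgcd p a b`,
`ḡ = s̄ ā + t̄ b̄`, `ḡ ∣ ā`, `ḡ ∣ b̄`, `g`, `s`, `t` are normal, and `g` is monic (in particular
nonempty) unless `ā = b̄ = 0`, in which case `g = []`. [cite: KnuthTAOCP2, §4.6.1] -/
theorem pxgcd_spec (a b : List ℤ) :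
    toZMod p (pxgcd p a b).1 = toZMod p (pxgcd p a b).2.1 * toZMod p a + toZMod p (pxgcd p a b).2.2 * toZMod p b ∧
      toZMod p (pxgcd p a b).1 ∣ toZMod p a ∧ toZMod p (pxgcd p a b).1 ∣ toZMod p b ∧
      Normal p (pxgcd p a b).1 ∧ Normal p (pxgcd p a b).2.1 ∧ Normal p (pxgcd p a b).2.2 ∧
      ((pxgcd p a b).1 = [] ↔ toZMod p a = 0 ∧ toZMod p b = 0) ∧
      ((pxgcd p a b).1 ≠ [] → (toZMod p (pxgcd p a b).1).Monic ∧
        (toZMod p (pxgcd p a b).1).natDegree = (pxgcd p a b).1.length - 1) := by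
  have hp0 : 0 < p := hp.out.pos
  set st := xgcdRun p a b (b.length + 1) with hst
  obtain ⟨⟨h0, h1, nr0, nr1, ns0, ns1, nt0, nt1, hdiv⟩, -⟩ := xgcdRun_spec (p := p) a b (b.length + 1)
  have hnil : st.1.2 = [] := xgcdRun_fst_snd_eq_nil a b
  rw [← hst] at h0 h1 nr0 nr1 ns0 ns1 nt0 nt1 hdiv
  have hg : (pxgcd p a b).1 = monicize p st.1.1 := rfl
  have hs : (pxgcd p a b).2.1 = pnorm p (pscale (monicizer p st.1.1) st.2.1.1) := rfl
  have ht : (pxgcd p a b).2.2 = pnorm p (pscale (monicizer p st.1.1) st.2.2.1) := rfl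
  have hgZ : toZMod p (pxgcd p a b).1 = C ((monicizer p st.1.1 : ℤ) : ZMod p) * toZMod p st.1.1 := by
    rw [hg, toZMod_monicize]
  -- the common divisors of `(r₀, 0)` are those of `(a, b)`
  have hdiv0 : ∀ d, d ∣ toZMod p st.1.1 ↔ d ∣ toZMod p a ∧ d ∣ toZMod p b := fun d => by
    rw [← hdiv d, hnil, toZMod_nil]; simp
  -- `g ∣ a`, `g ∣ b` (through `r₀`, of which `g` is a unit multiple, or `0`)
  have hgdvd : toZMod p (pxgcd p a b).1 ∣ toZMod p a ∧ toZMod p (pxgcd p a b).1 ∣ toZMod p b := by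
    have hr0dvd := (hdiv0 _).1 dvd_rfl
    by_cases hne' : st.1.1 = []
    · have hr0 : toZMod p st.1.1 = 0 := by rw [hne', toZMod_nil]
      rw [hr0] at hr0dvd
      rw [zero_dvd_iff.1 hr0dvd.1, zero_dvd_iff.1 hr0dvd.2]
      exact ⟨dvd_zero _, dvd_zero _⟩
    · obtain ⟨-, -, -, -, hunit⟩ := monicize_spec nr0 hne'
      obtain ⟨u, hu⟩ := isUnit_C.2 hunit
      rw [hgZ, ← hu, Units.mul_left_dvd, Units.mul_left_dvd]
      exact hr0dvd
  refine ⟨?_, ?_, ?_, ?_, normal_pnorm hp0 _, normal_pnorm hp0 _, ?_, ?_⟩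
  · rw [hgZ, hs, ht, toZMod_pnorm, toZMod_pnorm, toZMod_pscale, toZMod_pscale, h0]; ring
  · exact hgdvd.1
  · exact hgdvd.2
  · rw [hg]; exact normal_pnorm hp0 _
  · -- `g = []` iff both inputs vanish
    constructor
    · intro hg0
      have hr0 : toZMod p st.1.1 = 0 := by
        by_contra hne
        have hne' : st.1.1 ≠ [] := fun h => hne (by rw [h, toZMod_nil])
        obtain ⟨hmon, -⟩ := monicize_spec nr0 hne'
        rw [← hg, hg0, toZMod_nil] at hmon
        exact absurd hmon (fun h => by simpa using h.ne_zero)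
      have := (hdiv0 0).1 (by rw [hr0])
      exact ⟨zero_dvd_iff.1 this.1, zero_dvd_iff.1 this.2⟩
    · rintro ⟨ha0, hb0⟩
      have hr0 : toZMod p st.1.1 = 0 := by rw [h0, ha0, hb0]; ring
      have : st.1.1 = [] := nr0.toZMod_eq_zero_iff.1 hr0
      rw [hg, this]
      simp [monicize, pnorm, pmod, pscale, trim, List.rdropWhile]
  · intro hne
    have hne' : st.1.1 ≠ [] := by
      intro h; apply hne; rw [hg, h]; simp [monicize, pnorm, pmod, pscale, trim, List.rdropWhile]
    obtain ⟨hmon, hdeg, -, hlen, -⟩ := monicize_spec nr0 hne'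
    rw [← hg] at hmon hdeg hlen
    exact ⟨hmon, by rw [hdeg, hlen]⟩

/-- **Coprimality test**: `ā`, `b̄` are coprime in `𝔽_p[X]` iff the computed gcd is `[1]`.
[cite: LenstraLenstraLovasz1982, proof of (3.6) (the test R(f, f') ≢ 0 mod p, i.e. gcd(f, f') = 1)] -/
theorem isCoprime_iff_pgcd_eq_one (a b : List ℤ) : IsCoprime (toZMod p a) (toZMod p b) ↔ pgcd p a b = [1] := by
  obtain ⟨hbez, hda, hdb, hng, -, -, hnil, hmon⟩ := pxgcd_spec (p := p) a b
  rw [pgcd]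
  constructor
  · intro hcop
    have hunit : IsUnit (toZMod p (pxgcd p a b).1) := hcop.isUnit_of_dvd' hda hdb
    have hne : (pxgcd p a b).1 ≠ [] := fun h => by rw [h, toZMod_nil] at hunit; exact not_isUnit_zero hunit
    obtain ⟨hm, hdeg⟩ := hmon hne
    have hd0 : (toZMod p (pxgcd p a b).1).natDegree = 0 := natDegree_eq_zero_of_isUnit hunit
    have h1 : toZMod p (pxgcd p a b).1 = 1 := by
      exact eq_one_of_monic_natDegree_zero hm hd0
    exact (toZMod_eq_one_iff_of_normal hp.out.one_lt hng).1 h1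
  · intro h1
    have : toZMod p (pxgcd p a b).1 = 1 := (toZMod_eq_one_iff_of_normal hp.out.one_lt hng).2 h1
    rw [this] at hbez
    exact ⟨_, _, by rw [hbez]⟩

/-- The computed gcd is associated with Mathlib's normalised `gcd` of `𝔽_p[X]`. [cite: KnuthTAOCP2, §4.6.1] -/
theorem associated_pgcd_gcd [DecidableEq (ZMod p)] (a b : List ℤ) :
    Associated (toZMod p (pgcd p a b)) (gcd (toZMod p a) (toZMod p b)) := by
  obtain ⟨hbez, hda, hdb, -, -, -, -, -⟩ := pxgcd_spec (p := p) a b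
  refine associated_of_dvd_dvd (dvd_gcd hda hdb) ?_
  rw [pgcd, hbez]
  exact dvd_add (Dvd.dvd.mul_left (gcd_dvd_left _ _) _) (Dvd.dvd.mul_left (gcd_dvd_right _ _) _)

/-- **The degree of the gcd**: `deg gcd(ā, b̄) = |pgcd p a b| - 1` when not both inputs vanish.
[cite: KnuthTAOCP2, §4.6.1] -/
theorem natDegree_gcd_eq [DecidableEq (ZMod p)] {a b : List ℤ} (h : ¬(toZMod p a = 0 ∧ toZMod p b = 0)) :
    (gcd (toZMod p a) (toZMod p b)).natDegree = (pgcd p a b).length - 1 := by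
  obtain ⟨-, -, -, -, -, -, hnil, hmon⟩ := pxgcd_spec (p := p) a b
  have hne : (pxgcd p a b).1 ≠ [] := fun h0 => h (hnil.1 h0)
  obtain ⟨hm, hdeg⟩ := hmon hne
  show (gcd (toZMod p a) (toZMod p b)).natDegree = (pxgcd p a b).1.length - 1
  rw [← hdeg]
  exact (natDegree_eq_of_degree_eq (degree_eq_degree_of_associated (associated_pgcd_gcd a b))).symm

end Spec

end LLLFactoring

end Literature.Computability.Complexity
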